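import Summits.BirchSwinnertonDyer.Rank1Residual.X1.ParitySqueeze
import Summits.BirchSwinnertonDyer.Rank1Residual.X1.RankOne
import Literature.NumberTheory.EllipticCurves.BSDRankResidualCellsProofs
import HarnessLib

/-!
# Route P at RANK ONE on class X1: `λ_an = 1` (no squeeze needed) and the parity squeeze at `λ_an = 3`
# ⇒ Mazur's main conjecture ⇒ `BSD(E,p)`, from PUBLISHED facts and finite per-pair certificates

HONEST FRAMING (cell `b2b-bsdres`, run/shared/lean/b2b/bsd-rank1-residual/, verbatim in every
file): the goal of the cell is to DELETE the COMBINATION-SHAPED residual classes of the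
Birch–Swinnerton-Dyer formula for ALL analytic-rank `≤ 1` elliptic curves over `ℚ` — "full BSD
formula for every rank `≤ 1` curve in class `C`" assembled STRICTLY from published theorems — so
that the rank-`≤ 1` remainder becomes exactly the CONSTRUCTION-SHAPED classes, which are TYPED
(missing-input `Prop`s), NOT attempted. This is not "finishing BSD". Unit `b2b-bsdres-x1b` (prover B,
the independent patchwork — no Keller–Yin input), gen 8; research route; NO CLAIM BEYOND STATED
CLASSES; nothing here changes a label; no new named fact and no new typed def (the certificates are
eisenstein-p1's `AnalyticMuLE`, `MuPartAt`, `AnalyticLambdaEq` and a valuation bound on the tree's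
canonical `p`-adic regulator).

WHY THIS FILE. Sub-cell eisenstein-p1's route P (`X1/ParitySqueeze.lean`, Greenberg's parity squeeze,
LNM 1716 p. 183, made unconditional by Wuthrich's integral divisibility) closes Mazur's main
conjecture on the RANK-ZERO leaf from `(μ_an, λ_an) = (≤ m, 2)`; its gap map (X1R0-GAPMAP.md §13.3)
records the rank-one analogue as "not filed (not my class): `λ_an = 3`, `λ(f_E)` odd (Prop. 3.10 at
corank 1) `∈ {1, 3}`; excluding `λ(f_E) = 1` needs the RANK-ONE leading-term formula (Perrin-Riou /
Schneider) in place of Thm. 4.1". This file files it, on the rank-one leaf `RankOne.Leaf` of x1a's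
`X1/RankOne.lean` (BOTH Greenberg–Vatsal types), and adds the case the gap map did not mention:

* **`λ_an = 1` needs no squeeze at all** (`mazurMainConjecture_of_analyticLambdaEq_one`). Wuthrich
  2014 Thm. 16 gives `ϖ·L_p(f,α) = ι(f_E·h)`; the μ-part gives `μ(h) = 0`; Perrin-Riou–Schneider
  (Balakrishnan–Müller–Stein 2016 Thm. 1.7, clause (1): `ord_{T=0} f_E ≥ rank E(ℚ)`) with
  Gross–Zagier–Kolyvagin (`rank = 1`) gives `1 ≤ ord_T f_E ≤ λ(f_E) ≤ λ(f_E·h) = 1`, so `λ(h) = 0`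
  and `h ∈ Λˣ`: Mazur's main conjecture. On the leaf the same certificate makes `[T¹]L_p(f,α) ≠ 0`
  (`coeff_lam_ne_zero`), i.e. Schneider's non-degeneracy (x1a's converter, Perrin-Riou 1987), so
  **`μ_an = 0 ∧ λ_an = 1 ⇒ Mazur's MC ∧ BSD(E,p)`** with NO height computation, NO descent and NO
  value of `#Ш_an` (sibling file `X1/RankOneParitySqueezeLeaf.lean`,
  `RankOne.Leaf.mazurMainConjecture_and_bsdp_of_muZero_lamOne`; iw-2 census IWASAWA-CENSUS §4.4:
  250 + 10 of the 699 + 68 rank-one X1 pairs at `p = 3, 5` with `N < 2·10⁴`, all with two-engine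
  `μ_an = 0`).
* **`λ_an = 3`: the parity squeeze** (`mazurMainConjecture_of_analyticLambdaEq_three`). `λ(f_E)` is
  ODD (Greenberg Prop. 3.10 at `corank_{ℤ_p} Sel_{p^∞}(E/ℚ) = rank = 1`, Ш finite by GZK) and `≤ 3`;
  if `λ(f_E) = 1` then `ord_T f_E = 1 = rank`, so by BMS Thm. 1.7 (2)–(3) the canonical `p`-adic
  height IS non-degenerate and `[T¹]f_E · log_p(γ) · #E(ℚ)_tors² ∼ (1 − α⁻¹)² · #Ш[p^∞] · Reg_p · ∏c_ℓ`,
  while `[T¹]f_E = p^{μ(f_E)}·unit` with `μ(f_E) ≤ m`; valuations give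
  `m + 1 + 2·ord_p #E(ℚ)_tors ≥ 2·ord_p #Ẽ(𝔽_p) + v + ord_p ∏c_ℓ` for any certified lower bound `v` of
  `ord_p Reg_p` — so the per-pair inequality `hb : m + 2·ord_p #E(ℚ)_tors + 1 < v + ord_p ∏c_ℓ +
  2·ord_p #Ẽ(𝔽_p)` excludes it, `λ(f_E) = 3 = λ(f_E·h)`, `h ∈ Λˣ`. On the leaf, with the Schneider
  certificate in valued form (`Reg_p ≠ 0 ∧ v ≤ ord_p Reg_p`, the cell's ENGINE-3 column:
  `v = v_p(h_p(P)) + 1 = v_p(Reg_PARI)` in the tree's normalisation `⟨P,P⟩ = −2p·h_p(P)`),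
  **`(μ_an, λ_an) = (≤ m, 3)`, the μ-part and `hb` ⇒ Mazur's MC ∧ BSD(E,p)`** (sibling file; 314 of
  the 772 census pairs have `λ_an = 3`).
* A certified `λ_an` on the rank-one leaf is ODD (`X1/LambdaParity.lean`; sibling file
  `RankOne.Leaf.odd_of_analyticLambdaEq`), so the first case beyond these routes is `λ_an = 5` (198
  census pairs, e.g. `15834t1@5` with `λ_an = 9`).

What this is NOT: a class theorem (the certificates are per pair); a replacement for the descent /
Cassels–Tate / `p ∤ #Ш_an` + Schneider routes already in the tree (`X1.bsdp_of_noPTorsion`,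
`CasselsTateIsogenyCertificate`, `RankOne.Leaf.mazurMainConjecture_and_bsdp_of_shaAn_unit_of_schneider`)
— it is a THIRD, `Ш`-free and descent-free certificate route at rank one, the exact mirror of route P
at rank zero. Algebra addenda (§1): `ord_T g ≤ λ(g)`, `[T^{λ(g)}] g = p^{μ(g)}·unit`,
`isUnit_of_mu_le_of_lam_le`.

References: [GreenbergLNM1716] Prop. 3.10, §4 p. 110, §5 p. 183; [Wuthrich2014] Thm. 16;
[BalakrishnanMullerStein2015] Thm. 1.7; [PerrinRiou1987] §1.4 Cor. 1.8; [GreenbergVatsal2000] (1)–(2);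
HOME/b2b-bsdres-eisenstein-p1/X1R0-GAPMAP.md §13.3; HOME/b2b-bsdres-iw-2/IWASAWA-CENSUS.md §4.4;
HOME/b2b-bsdres-x1b/X1-B.md §13.
-/

noncomputable section

open scoped Classical MatrixGroups ModularForm

open PowerSeries CongruenceSubgroup WeierstrassCurve Literature.NumberTheory.EllipticCurves
  Literature.NumberTheory.EllipticCurves.ModularForms
  Literature.NumberTheory.EllipticCurves.Rank1Residual
  Literature.NumberTheory.EllipticCurves.Greenberg1999
  Summit.BirchSwinnertonDyer.BirchSwinnertonDyer.Theorems.Rank1ResidualX1Defs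
  Summit.BirchSwinnertonDyer.Rank1Residual.X1.MuLambda
  Summit.BirchSwinnertonDyer.Rank1Residual.X1.MuPart
  Summit.BirchSwinnertonDyer.Rank1Residual.X1.ParitySqueeze

set_option autoImplicit false

namespace Summit.BirchSwinnertonDyer.Rank1Residual.X1.RankOneParitySqueeze

/-! ## §1. `Λ`-algebra addenda: `ord_T g ≤ λ(g)`; the coefficient `[T^{λ(g)}] g` is `p^{μ(g)}` times a unit -/

section Algebra

variable {p : ℕ} [Fact p.Prime]

/-- **`[T^{λ(g)}] g = p^{μ(g)} · u` with `u ∈ ℤ_pˣ`** for `g ≠ 0`: writing `g = p^{μ} g₀` with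
`g₀ ≢ 0 (mod p)`, the reduction of `g₀` has order exactly `λ(g)`, so `[T^{λ}] g₀` is a unit
(Washington §7.1: `λ` = degree of the distinguished polynomial; Greenberg–Vatsal (1)–(2)).
[cite: Washington1997, §7.1] -/
theorem exists_unit_coeff_lam {g : IwasawaAlgebra p} (hg : g ≠ 0) :
    ∃ u : ℤ_[p]ˣ, coeff (lam g) g = (p : ℤ_[p]) ^ mu g * u := by
  have hredne : red (pfree g) ≠ 0 := red_pfree_ne_zero hg
  -- the coefficient of `T^{λ(g)}` of the reduction of the `p`-free part is nonzero
  have hc : coeff (lam g) (red (pfree g)) ≠ 0 := coeff_order hredne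
  rw [coeff_map] at hc
  have hunit : IsUnit (coeff (lam g) (pfree g)) := by
    by_contra hnu
    exact hc ((IsLocalRing.residue_eq_zero_iff _).mpr ((IsLocalRing.mem_maximalIdeal _).mpr hnu))
  obtain ⟨u, hu⟩ := hunit
  refine ⟨u, ?_⟩
  have e := congrArg (coeff (lam g)) (eq_C_pow_mu_mul_pfree g)
  rw [coeff_C_mul, ← hu] at e
  exact e

/-- `[T^{λ(g)}] g ≠ 0` for `g ≠ 0`. [cite: Washington1997, §7.1] -/
theorem coeff_lam_ne_zero {g : IwasawaAlgebra p} (hg : g ≠ 0) : coeff (lam g) g ≠ 0 := by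
  obtain ⟨u, hu⟩ := exists_unit_coeff_lam hg
  rw [hu]
  exact mul_ne_zero (pow_ne_zero _ (by exact_mod_cast (Fact.out : p.Prime).ne_zero)) u.ne_zero

/-- **`ord_{T=0} g ≤ λ(g)`** for `g ≠ 0` in `Λ = ℤ_p⟦T⟧` (the distinguished polynomial of `g` has degree
`λ(g)`, so `g` cannot vanish to order `> λ(g)` at `T = 0`). [cite: Washington1997, §7.1] -/
theorem order_le_lam {g : IwasawaAlgebra p} (hg : g ≠ 0) : g.order ≤ (lam g : ℕ∞) :=
  order_le (lam g) (coeff_lam_ne_zero hg)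

/-- Valuation of `[T^{λ(g)}] g` in `ℚ_p`: it is `μ(g)` (and the coefficient is nonzero).
[cite: Washington1997, §7.1] -/
theorem valuation_coeff_lam {g : IwasawaAlgebra p} (hg : g ≠ 0) :
    ((coeff (lam g) g : ℤ_[p]) : ℚ_[p]) ≠ 0 ∧
      (((coeff (lam g) g : ℤ_[p]) : ℚ_[p])).valuation = mu g := by
  have hpP : p.Prime := Fact.out
  obtain ⟨u, hu⟩ := exists_unit_coeff_lam hg
  have hp0 : (p : ℚ_[p]) ≠ 0 := Nat.cast_ne_zero.mpr hpP.ne_zero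
  have hcast : ((coeff (lam g) g : ℤ_[p]) : ℚ_[p]) = (p : ℚ_[p]) ^ mu g * ((u : ℤ_[p]) : ℚ_[p]) := by
    rw [hu]; push_cast; rfl
  refine ⟨?_, ?_⟩
  · rw [hcast]
    exact mul_ne_zero (pow_ne_zero _ hp0) (coe_units_ne_zero p u)
  · rw [hcast, Padic.valuation_mul (pow_ne_zero _ hp0) (coe_units_ne_zero p u), Padic.valuation_pow,
      Padic.valuation_p, valuation_coe_units_eq_zero]
    simp

/-- **The one-inequality squeeze (pure algebra).** For nonzero `g, h ∈ Λ` with `μ(g·h) ≤ μ(g)` and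
`λ(g·h) ≤ λ(g)`, `h` is a unit (the reverse inequalities are automatic: `μ`, `λ` are additive).
[cite: GreenbergVatsal2000, p. 4 (after Thm. (1.2))] -/
theorem isUnit_of_mu_le_of_lam_le {g h : IwasawaAlgebra p} (hg : g ≠ 0) (hh : h ≠ 0)
    (hμ : mu (g * h) ≤ mu g) (hl : lam (g * h) ≤ lam g) : IsUnit h := by
  rw [isUnit_iff_mu_eq_zero_and_lam_eq_zero]
  rw [mu_mul hg hh] at hμ
  rw [lam_mul hg hh] at hl
  exact ⟨hh, by omega, by omega⟩

end Algebra

/-! ## §2. The two rank-one routes to Mazur's main conjecture -/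

section Squeeze

variable {W : WeierstrassCurve ℚ} [W.IsElliptic] [W.IsGloballyMinimal] {p : ℕ} [Fact p.Prime]

/-- **Rank one, `λ_an = 1`: Mazur's main conjecture with no squeeze.** Let `W/ℚ` be globally minimal
elliptic, `p ≠ 2` good ordinary with `E[p]` reducible and `ord_{s=1} L(E,s) = 1`. Granted the
PUBLISHED named facts Wuthrich 2014 Thm. 16 (`hW16`), Perrin-Riou–Schneider at odd `p` (`hS`, only
clause (1) `ord_{T=0} f_E ≥ rank E(ℚ)` is used), the Mazur–Tate sigma function at odd `p` (`hMT`, to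
instantiate THE canonical height datum the fact is stated over) and Gross–Zagier–Kolyvagin (`hGZK`,
`rank E(ℚ) = 1`), and the per-pair data `MuPartAt W p` (the μ-part) and `AnalyticLambdaEq W p 1`
(`λ_an = 1`): MAZUR'S MAIN CONJECTURE holds at `(E,p)`. Proof: `ϖ·L_p = ι(f_E·h)`,
`1 = rank ≤ ord_T f_E ≤ λ(f_E) ≤ λ(f_E·h) = 1` and `μ(f_E·h) ≤ μ(f_E)` force `μ(h) = λ(h) = 0`.
[cite: Wuthrich2014, Thm. 16 (p. 393)] [cite: BalakrishnanMullerStein2015, Thm. 1.7 (1)]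
[cite: GreenbergVatsal2000, p. 4] -/
theorem mazurMainConjecture_of_analyticLambdaEq_one
    (hW16 : Wuthrich2014.charIdeal_dvd_padicLFunction) (hS : Schneider1985_order_charGenerator_odd)
    (hMT : mazur_tate_sigma_exists_odd) (hGZK : rank_eq_analyticRank_of_analyticRank_le_one)
    (hp : p ≠ 2) (hgood : W.HasGoodReductionAtPrime p) (hord : ¬ (p : ℤ) ∣ W.frobeniusTrace p)
    (hred : ¬ W.HasIrreducibleModPGaloisRep p) (han : W.analyticRank = 1)
    (hμ : MuPartAt W p) (hlam1 : AnalyticLambdaEq W p 1) :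
    MazurMainConjecture W p := by
  intro κ γ hκ hγ hγ' _ f hf ϖ hϖ D
  have hordp : IsOrdinaryAt W p := ⟨hgood, hord⟩
  haveI : Module.Finite (IwasawaAlgebra p) D.X := D.module_finite_holds hγ
  -- Wuthrich Thm. 16: `X` torsion, `ι g = ϖ · L_p(f, α)` with `g ∈ char X = (fE)`, `g = fE · h`
  obtain ⟨hX, g, hgmem, hιg⟩ := hW16 W p hp hordp hred hκ hγ hγ' hf D ϖ hϖ
  haveI : (Literature.NumberTheory.EllipticCurves.Module.charIdeal (IwasawaAlgebra p) D.X).IsPrincipal :=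
    charIdeal_isPrincipal_holds p D.X
  obtain ⟨fE, hchar⟩ := Submodule.IsPrincipal.principal
    (Literature.NumberTheory.EllipticCurves.Module.charIdeal (IwasawaAlgebra p) D.X)
  have hchar' : D.charIdeal = Ideal.span {fE} := hchar
  have hgmem' : g ∈ Ideal.span {fE} := by rw [← hchar']; exact hgmem
  obtain ⟨h, hgh⟩ := Ideal.mem_span_singleton'.mp hgmem'
  have hfac : fE * h = g := by rw [mul_comm]; exact hgh
  have hιg' : iwasawaToPowerSeries p (fE * h) =
      C (ϖ : ℚ_[p]) * padicLFunction f (unitRoot W p : ℚ_[p]) := by rw [hfac, hιg]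
  have hg0 : fE * h ≠ 0 := mul_ne_zero_of_iota_eq hgood hord hf hϖ D hιg'
  have hfE0 : fE ≠ 0 := fun h0 ↦ hg0 (by rw [h0, zero_mul])
  have hh0 : h ≠ 0 := fun h0 ↦ hg0 (by rw [h0, mul_zero])
  -- the two certificates
  have hμ' : mu (fE * h) ≤ mu fE := hμ κ γ hκ hγ hγ' f hf ϖ hϖ D fE h hchar' hιg'
  have hlam' : lam (fE * h) = 1 := hlam1 f hf ϖ hϖ (fE * h) hιg'
  -- Gross–Zagier–Kolyvagin: rank one; Perrin-Riou–Schneider (1): `rank ≤ ord_T fE`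
  obtain ⟨hrk, -⟩ := hGZK W han.le
  have hr1 : W.mordellWeilRank = 1 := hrk.trans han
  obtain ⟨Dh, hDh, -⟩ := existsUnique_isCanonical_of_odd hMT W p hp hgood hord
  obtain ⟨hS1, -, -⟩ := hS W p hp hgood hord κ γ hκ hγ hγ' D hX fE hchar' Dh hDh
  rw [hr1] at hS1
  have h1 : 1 ≤ lam fE := by
    have e : ((1 : ℕ) : ℕ∞) ≤ (lam fE : ℕ∞) := hS1.trans (order_le_lam hfE0)
    exact_mod_cast e
  -- the squeeze-free conclusion: `λ(fE·h) = 1 ≤ λ(fE)`, `μ(fE·h) ≤ μ(fE)` ⇒ `h ∈ Λˣ`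
  have hunit : IsUnit h := isUnit_of_mu_le_of_lam_le hfE0 hh0 hμ' (by rw [hlam']; exact h1)
  refine ⟨hX, g, ?_, hιg⟩
  rw [hchar', ← hfac]
  exact ((span_eq_span_iff_isUnit hfE0 rfl).mpr hunit).symm

/-- **Rank one, `λ_an = 3`: the parity squeeze** (Greenberg's argument of LNM 1716 p. 183 transposed
to corank one, made unconditional by Wuthrich's integral divisibility and decided by the RANK-ONE
leading-term formula). Let `W/ℚ` be globally minimal elliptic, `p ≠ 2` good ordinary with `E[p]`
reducible and `ord_{s=1} L(E,s) = 1`. Granted the PUBLISHED named facts Wuthrich 2014 Thm. 16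
(`hW16`), Perrin-Riou–Schneider at odd `p` (`hS`, all three clauses), the Mazur–Tate sigma function
(`hMT`), Gross–Zagier–Kolyvagin (`hGZK`: rank `1`, `Ш` finite) and Greenberg's Prop. 3.10 (`h310`),
and the per-pair data `AnalyticMuLE W p m` (`μ_an ≤ m`), `MuPartAt W p`, `AnalyticLambdaEq W p 3`
(`λ_an = 3`), a lower bound `v ≤ ord_p Reg_p(E)` for THE canonical cyclotomic `p`-adic regulator
(`hv`; the tree's normalisation `⟨P,P⟩ = -2p·h_p(P)`), and
`hb : m + 2·ord_p #E(ℚ)_tors + 1 < v + ord_p ∏_ℓ c_ℓ + 2·ord_p #Ẽ(𝔽_p)`: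
MAZUR'S MAIN CONJECTURE holds at `(E,p)`. Proof in the module docstring (`λ(f_E)` odd, `≤ 3`, and
`λ(f_E) = 1` contradicts `hb` through BMS Thm. 1.7 (2)–(3) and `ord_p log_p(γ) = 1`).
[cite: GreenbergLNM1716, Prop. 3.10 and §5 p. 183] [cite: Wuthrich2014, Thm. 16 (p. 393)]
[cite: BalakrishnanMullerStein2015, Thm. 1.7] [cite: Iwasawa1972PadicL, §4.4] -/
theorem mazurMainConjecture_of_analyticLambdaEq_three
    (hW16 : Wuthrich2014.charIdeal_dvd_padicLFunction) (hS : Schneider1985_order_charGenerator_odd)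
    (hMT : mazur_tate_sigma_exists_odd) (hGZK : rank_eq_analyticRank_of_analyticRank_le_one)
    (h310 : prop310_selmerCorank_mod_two_eq_lambdaInvariant)
    (hp : p ≠ 2) (hgood : W.HasGoodReductionAtPrime p) (hord : ¬ (p : ℤ) ∣ W.frobeniusTrace p)
    (hred : ¬ W.HasIrreducibleModPGaloisRep p) (han : W.analyticRank = 1)
    {m : ℕ} (hμan : AnalyticMuLE W p m) (hμ : MuPartAt W p) (hlam3 : AnalyticLambdaEq W p 3)
    {v : ℤ} (hv : ∀ Dh : PAdicHeightData W p, Dh.IsCanonical → v ≤ (padicRegulator Dh).valuation)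
    (hb : (m : ℤ) + 2 * padicValNat p W.torsionOrder + 1 <
      v + padicValNat p W.tamagawaProduct + 2 * padicValNat p (W.reductionPointCount p)) :
    MazurMainConjecture W p := by
  intro κ γ hκ hγ hγ' _ f hf ϖ hϖ D
  have hpP : p.Prime := Fact.out
  have hordp : IsOrdinaryAt W p := ⟨hgood, hord⟩
  haveI : Module.Finite (IwasawaAlgebra p) D.X := D.module_finite_holds hγ
  -- Wuthrich Thm. 16: `X` torsion, `ι g = ϖ · L_p(f, α)` with `g ∈ char X = (fE)`, `g = fE · h`
  obtain ⟨hX, g, hgmem, hιg⟩ := hW16 W p hp hordp hred hκ hγ hγ' hf D ϖ hϖ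
  haveI : (Literature.NumberTheory.EllipticCurves.Module.charIdeal (IwasawaAlgebra p) D.X).IsPrincipal :=
    charIdeal_isPrincipal_holds p D.X
  obtain ⟨fE, hchar⟩ := Submodule.IsPrincipal.principal
    (Literature.NumberTheory.EllipticCurves.Module.charIdeal (IwasawaAlgebra p) D.X)
  have hchar' : D.charIdeal = Ideal.span {fE} := hchar
  have hgmem' : g ∈ Ideal.span {fE} := by rw [← hchar']; exact hgmem
  obtain ⟨h, hgh⟩ := Ideal.mem_span_singleton'.mp hgmem'
  have hfac : fE * h = g := by rw [mul_comm]; exact hgh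
  have hιg' : iwasawaToPowerSeries p (fE * h) =
      C (ϖ : ℚ_[p]) * padicLFunction f (unitRoot W p : ℚ_[p]) := by rw [hfac, hιg]
  have hg0 : fE * h ≠ 0 := mul_ne_zero_of_iota_eq hgood hord hf hϖ D hιg'
  have hfE0 : fE ≠ 0 := fun h0 ↦ hg0 (by rw [h0, zero_mul])
  have hh0 : h ≠ 0 := fun h0 ↦ hg0 (by rw [h0, mul_zero])
  -- the certificates: μ-part, `μ_an ≤ m`, `λ_an = 3`
  have hμ' : mu (fE * h) ≤ mu fE := hμ κ γ hκ hγ hγ' f hf ϖ hϖ D fE h hchar' hιg'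
  have hμm : mu (fE * h) ≤ m := by
    obtain ⟨n, hn⟩ := hμan f hf ϖ hϖ
    rw [← hιg'] at hn
    exact mu_le_of_lt_norm_coeff hn
  have hμfE : mu fE ≤ m := (mu_le_mu_mul hfE0 hh0).trans hμm
  have hlam' : lam (fE * h) = 3 := hlam3 f hf ϖ hϖ (fE * h) hιg'
  have hle3 : lam fE ≤ 3 := by rw [← hlam']; exact lam_le_lam_mul hfE0 hh0
  -- Gross–Zagier–Kolyvagin: rank one, `Ш` finite; `corank Sel_{p^∞}(E/ℚ) = 1`; `λ(fE)` is ODD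
  obtain ⟨hrk, hfin⟩ := hGZK W han.le
  haveI : Finite W.sha := hfin
  have hr1 : W.mordellWeilRank = 1 := hrk.trans han
  have hfinp : Finite (AddCommGroup.primaryComponent W.sha p) := inferInstance
  have hcork : W.selmerCorank p = 1 := by
    rw [selmerCorank_eq_mordellWeilRank_of_finite_shaPrimary W p hfinp, hr1]
  have hodd : Odd (lam fE) := by
    rw [lam_generator_eq_lambdaInvariant D.X hX hfE0 hchar']
    exact prop310_selmerCorank_mod_two_eq_lambdaInvariant.odd_lambdaInvariant_of_selmerCorank_eq_one
      h310 W p hp hκ hγ D hX hcork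
  -- THE canonical height datum; Perrin-Riou–Schneider (all clauses) at `(D, fE, Dh)`
  obtain ⟨Dh, hDh, -⟩ := existsUnique_isCanonical_of_odd hMT W p hp hgood hord
  obtain ⟨hS1, hS2, hS3⟩ := hS W p hp hgood hord κ γ hκ hγ hγ' D hX fE hchar' Dh hDh
  -- `λ(fE) ≠ 1`
  have hne1 : lam fE ≠ 1 := by
    intro h1
    -- then `ord_T fE = 1 = rank`, so the height is non-degenerate and the leading-term formula holds
    have hordfE : fE.order = W.mordellWeilRank := by
      refine le_antisymm ?_ hS1
      have e := order_le_lam hfE0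
      rw [h1] at e
      rw [hr1]
      exact_mod_cast e
    obtain ⟨hSch, hfin'⟩ := hS2.mp hordfE
    obtain ⟨u, hu⟩ := hS3 hSch hfin'
    rw [hr1, pow_one] at hu
    -- `[T¹] fE = p^{μ(fE)} · unit`
    obtain ⟨hc0, hcval⟩ := valuation_coeff_lam hfE0
    rw [h1] at hc0 hcval
    -- abbreviations in `ℚ_p`
    set c1 : ℚ_[p] := ((coeff 1 fE : ℤ_[p]) : ℚ_[p]) with hc1
    set lg : ℚ_[p] := padicLog p (cyclotomicGenerator p) with hlg
    set Tt : ℚ_[p] := (W.torsionOrder : ℚ_[p]) with hTt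
    set ε : ℚ_[p] := (1 - (unitRoot W p : ℚ_[p])⁻¹) with hε
    set Shp : ℚ_[p] := (Nat.card (AddCommGroup.primaryComponent W.sha p) : ℚ_[p]) with hShp
    set Rg : ℚ_[p] := padicRegulator Dh with hRg
    set Cc : ℚ_[p] := (W.tamagawaProduct : ℚ_[p]) with hCc
    -- non-vanishing of every factor
    obtain ⟨u₃, hu₃⟩ := exists_unit_padicLog_cyclotomicGenerator p hp
    have hp0 : (p : ℚ_[p]) ≠ 0 := Nat.cast_ne_zero.mpr hpP.ne_zero
    have hlg' : lg = (p : ℚ_[p]) * ((u₃ : ℤ_[p]) : ℚ_[p]) := by rw [hlg]; exact hu₃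
    have hlg0 : lg ≠ 0 := by rw [hlg']; exact mul_ne_zero hp0 (coe_units_ne_zero p u₃)
    have hTt0 : Tt ≠ 0 := by rw [hTt]; exact_mod_cast (W.torsionOrder_pos_holds).ne'
    obtain ⟨u₂, hu₂⟩ := exists_unit_one_sub_unitRoot_inv p W hordp
    have hε' : ε = ((u₂ : ℤ_[p]) : ℚ_[p]) * (W.reductionPointCount p : ℚ_[p]) := by rw [hε]; exact hu₂
    have hN0 : (W.reductionPointCount p : ℚ_[p]) ≠ 0 := by exact_mod_cast (W.reductionPointCount_pos p).ne'
    have hε0 : ε ≠ 0 := by rw [hε']; exact mul_ne_zero (coe_units_ne_zero p u₂) hN0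
    have hShp0 : Shp ≠ 0 := by rw [hShp]; exact_mod_cast Nat.card_pos.ne'
    have hRg0 : Rg ≠ 0 := hSch
    have hCc0 : Cc ≠ 0 := by
      rw [hCc]; exact_mod_cast (W.tamagawaProduct_pos_holds : 0 < W.tamagawaProduct).ne'
    -- valuations of the factors
    have hvlg : lg.valuation = 1 := by
      rw [hlg', Padic.valuation_mul hp0 (coe_units_ne_zero p u₃), Padic.valuation_p,
        valuation_coe_units_eq_zero, add_zero]
    have hvT : Tt.valuation = (padicValNat p W.torsionOrder : ℤ) := by
      rw [hTt, Padic.valuation_natCast]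
    have hvε : ε.valuation = (padicValNat p (W.reductionPointCount p) : ℤ) := by
      rw [hε', Padic.valuation_mul (coe_units_ne_zero p u₂) hN0, valuation_coe_units_eq_zero, zero_add,
        Padic.valuation_natCast]
    have hvS : 0 ≤ Shp.valuation := by
      rw [hShp, Padic.valuation_natCast]; exact_mod_cast Nat.zero_le _
    have hvR : v ≤ Rg.valuation := hv Dh hDh
    have hvC : Cc.valuation = (padicValNat p W.tamagawaProduct : ℤ) := by
      rw [hCc, Padic.valuation_natCast]
    -- take valuations in the leading-term identity `c1 · lg · Tt² = u · (ε² · (Shp · (Rg · Cc)))`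
    have hval := congrArg Padic.valuation hu
    rw [Padic.valuation_mul (mul_ne_zero hc0 hlg0) (pow_ne_zero 2 hTt0), Padic.valuation_mul hc0 hlg0,
      Padic.valuation_pow,
      Padic.valuation_mul (coe_units_ne_zero p u) (mul_ne_zero (pow_ne_zero 2 hε0)
        (mul_ne_zero (mul_ne_zero hShp0 hRg0) hCc0)),
      valuation_coe_units_eq_zero, zero_add,
      Padic.valuation_mul (pow_ne_zero 2 hε0) (mul_ne_zero (mul_ne_zero hShp0 hRg0) hCc0),
      Padic.valuation_pow, Padic.valuation_mul (mul_ne_zero hShp0 hRg0) hCc0,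
      Padic.valuation_mul hShp0 hRg0, hcval, hvlg, hvT, hvε, hvC] at hval
    -- `μ(fE) ≤ m` and `hb` contradict `hval`
    have hμfE' : (mu fE : ℤ) ≤ m := by exact_mod_cast hμfE
    push_cast at hval hb
    linarith
  -- hence `λ(fE) = 3 = λ(fE·h)` and `h ∈ Λˣ`
  have h3 : lam fE = 3 := by
    obtain ⟨k, hk⟩ := hodd
    omega
  have hunit : IsUnit h := isUnit_of_mu_le_of_lam_le hfE0 hh0 hμ' (by rw [hlam', h3])
  refine ⟨hX, g, ?_, hιg⟩
  rw [hchar', ← hfac]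
  exact ((span_eq_span_iff_isUnit hfE0 rfl).mpr hunit).symm

end Squeeze

end Summit.BirchSwinnertonDyer.Rank1Residual.X1.RankOneParitySqueeze

end
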